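import Mathlib
import HarnessLib
import Literature.MathematicalPhysics.QuantumFieldTheory.Balaban1983to89.B10Eq18SigmaSU2Haar
import Summits.Ventures.LatticeQCDFlow.Exactness.CompactHaar

/-!
# One exponential kick of a Lebesgue-minorised momentum dominates a multiple of Haar measure on `SU(2)`

HONEST FRAMING: exact (Metropolis-corrected) sampling algorithms for lattice gauge theory;
figures of merit are autocorrelation/cost numbers at stated couplings and volumes; no
continuum-physics claim.

Venture `LatticeQCDFlow` (cell pub-lqcd), topic `Exactness`, FANOUT row 9 (eng-latcore, the
engine `latflow.core`: the link drift `U ← exp(ε P) U` of `hmc.HMC` and the kick `U ← exp(X) U` of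
`updates.sweep_metropolis`).  NEW WORK of the cell over Mathlib and the tree; nothing here is cited
as a fact.  The measure-level exponential chart of `SU(2)` is IMPORTED BY NAME from the literature
formalisation `Balaban1983to89.B10Eq18SigmaSU2Haar` (Bałaban, CMP 102 (1985) p. 260, «dU′ = σ(A′)dA′,
σ(A) = 1/2π² (sin|A|/|A|)²»: `map_expPauli_sigmaMeasure`, the chart `expPauli A = exp(iΣσ_aA^a)`),
itself resting on pub-balaban's `T4HaarSU2ExpChart`; nothing of it is re-proved.

THE POINT.  The Haar density in the chart is `σ(|A|) = (2π²)⁻¹ sinc²|A| ≤ (2π²)⁻¹` on the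
injectivity ball `|A| < π`, so Lebesgue measure on that ball, pushed through the chart, DOMINATES
`2π² ·` Haar.  Consequently any momentum law with a positive Lebesgue density on a large enough ball
— a Gaussian, a box-uniform after enough convolutions — drives the link, in ONE exponential drift,
to a law dominating a multiple of Haar measure: the group-specific input of the Doeblin certificate
for single-step leapfrog HMC (`LeapfrogHMCDoeblin.lean`, `SU2LeapfrogHMCErgodic.lean`).

* §1 `sigmaSU2_norm_le`, `sigmaMeasure_le_smul_restrict` — `σ(A)dA ≤ (2π²)⁻¹ · d³A|_{|A|<π}`;
  **`smul_haarProbability_le_map_expPauli`** — `2π² • Haar_{SU(2)} ≤ (d³A|_{|A|<π}) ∘ expPauli⁻¹`.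
* §2 `map_smul_restrict_ball` — Lebesgue scaling of a ball in `ℝ³`;
  **`smul_haarProbability_le_map_expPauli_smul`** — with a step size `ε > 0`,
  `(2π²/ε³) • Haar ≤ (d³A|_{|A|<π/ε}) ∘ (A ↦ exp(iε A·σ))⁻¹`.
* §3 `map_add_left_restrict_ball`, `restrict_ball_le_map_add_left` — a kicked (translated) ball
  still contains the injectivity ball; **`smul_haarProbability_le_map_kickDrift`** — for
  `π/ε + |v| ≤ R` and any link value `u`, `(2π²/ε³) • Haar ≤ (d³A|_{|A|<R}) ∘ (A ↦ exp(iε(v + A)·σ)·u)⁻¹`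
  (right-invariance of Haar absorbs `u`): the law of ONE drift of a momentum uniform on a ball,
  after any bounded kick `v`, dominates a multiple of Haar measure, uniformly in `u` and `v`.
* §4 `expPauli_neg` — `exp(−iA·σ) = exp(iA·σ)⁻¹` (the time-reversal law of the drift),
  `continuous_kickDrift` / `measurable_kickDrift`.

NOT here: `SU(N ≥ 3)` (no exponential-chart Haar density for `SU(N)`, `N ≥ 3`, exists in the
tree), convolution powers of small kicks (what the N-hit Metropolis sweep at the engine's default
`step = 0.3` would need), any number beyond the constant `2π²/ε³`.
-/

noncomputable section

namespace Summit.Ventures.LatticeQCDFlow.Exactness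

open MeasureTheory Measure Set Metric NormedSpace
open Literature.MathematicalPhysics.QuantumFieldTheory (haarProbability)
open Literature.MathematicalPhysics.QuantumLattice (su2Quat quatMatrix_su2Quat)
open Literature.MathematicalPhysics.QuantumFieldTheory.Balaban1983to89 (T4HaarSU2Translate.su2Quat_mul
  T4HaarSU2Translate.su2Quat_one)
open Literature.MathematicalPhysics.QuantumFieldTheory.Balaban1983to89.T4HaarSU2ExpChart
  (expPoint su2Quat_expPoint imQuat expWeight_le)
open Literature.MathematicalPhysics.QuantumFieldTheory.Balaban1983to89.B10Eq22Rescaling (sigmaSU2)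
open Literature.MathematicalPhysics.QuantumFieldTheory.Balaban1983to89.B10Eq18SigmaSU2Haar
  (rev expPauli expPauli_eq_expPoint measurable_expPauli continuous_expPauli sigmaMeasure
    map_expPauli_sigmaMeasure sigmaSU2_norm_eq_expWeight)
open scoped ENNReal Quaternion

/-! ## §1 The chart density is bounded by `(2π²)⁻¹`: Lebesgue on the injectivity ball dominates `2π² ·` Haar -/

/-- The Haar density in the exponential chart is at most its value at the origin:
`σ(|A|) = (2π²)⁻¹ sinc²|A| ≤ (2π²)⁻¹`. -/
theorem sigmaSU2_norm_le (A : EuclideanSpace ℝ (Fin 3)) : sigmaSU2 ‖A‖ ≤ (2 * Real.pi ^ 2)⁻¹ := by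
  rw [sigmaSU2_norm_eq_expWeight]
  exact expWeight_le A

/-- `σ(A)dA ≤ (2π²)⁻¹ · d³A|_{|A|<π}` as measures on `ℝ³`. -/
theorem sigmaMeasure_le_smul_restrict :
    sigmaMeasure ≤ ENNReal.ofReal ((2 * Real.pi ^ 2)⁻¹) • volume.restrict (ball (0 : EuclideanSpace ℝ (Fin 3)) Real.pi) := by
  rw [sigmaMeasure, ← withDensity_const]
  exact withDensity_mono (Filter.Eventually.of_forall fun A => ENNReal.ofReal_le_ofReal (sigmaSU2_norm_le A))

/-- **`2π² • Haar_{SU(2)} ≤ (Lebesgue on the ball `|A| < π`) pushed through the chart `A ↦ exp(iA·σ)`.**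
The normalised Haar measure IS `σ(A)dA` pushed through the chart (`map_expPauli_sigmaMeasure`) and
`σ ≤ (2π²)⁻¹`. -/
theorem smul_haarProbability_le_map_expPauli :
    ENNReal.ofReal (2 * Real.pi ^ 2) • haarProbability (Matrix.specialUnitaryGroup (Fin 2) ℂ) ≤
      (volume.restrict (ball (0 : EuclideanSpace ℝ (Fin 3)) Real.pi)).map expPauli := by
  rw [← map_expPauli_sigmaMeasure]
  refine Measure.le_iff.2 fun s hs => ?_
  have hle := Measure.le_iff.1 sigmaMeasure_le_smul_restrict (expPauli ⁻¹' s) (measurable_expPauli hs)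
  rw [Measure.smul_apply, smul_eq_mul] at hle
  rw [Measure.smul_apply, smul_eq_mul, Measure.map_apply measurable_expPauli hs,
    Measure.map_apply measurable_expPauli hs]
  have hpos : (0 : ℝ) < 2 * Real.pi ^ 2 := by positivity
  calc ENNReal.ofReal (2 * Real.pi ^ 2) * sigmaMeasure (expPauli ⁻¹' s)
      ≤ ENNReal.ofReal (2 * Real.pi ^ 2) *
          (ENNReal.ofReal ((2 * Real.pi ^ 2)⁻¹) * volume.restrict (ball (0 : EuclideanSpace ℝ (Fin 3)) Real.pi) (expPauli ⁻¹' s)) := by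
        gcongr
    _ = volume.restrict (ball (0 : EuclideanSpace ℝ (Fin 3)) Real.pi) (expPauli ⁻¹' s) := by
        rw [← mul_assoc, ← ENNReal.ofReal_mul hpos.le, mul_inv_cancel₀ hpos.ne', ENNReal.ofReal_one,
          one_mul]

/-! ## §2 A step size: Lebesgue scaling of the ball -/

/-- The scaling `A ↦ ε • A` is measurable. -/
theorem measurable_smul_euclidean3 (ε : ℝ) : Measurable fun A : EuclideanSpace ℝ (Fin 3) => ε • A := measurable_const_smul ε

/-- Lebesgue scaling in `ℝ³`: `(d³A|_{|A|<R}) ∘ (ε •)⁻¹ = ε⁻³ · d³A|_{|A|<εR}` for `ε > 0`. -/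
theorem map_smul_restrict_ball {ε : ℝ} (hε : 0 < ε) (R : ℝ) :
    (volume.restrict (ball (0 : EuclideanSpace ℝ (Fin 3)) R)).map (fun A : EuclideanSpace ℝ (Fin 3) => ε • A) =
      ENNReal.ofReal ((ε ^ 3)⁻¹) • volume.restrict (ball (0 : EuclideanSpace ℝ (Fin 3)) (ε * R)) := by
  have hpre : (fun A : EuclideanSpace ℝ (Fin 3) => ε • A) ⁻¹' ball 0 (ε * R) = ball 0 R := by
    ext A
    simp only [mem_preimage, mem_ball_zero_iff, norm_smul, Real.norm_eq_abs, abs_of_pos hε]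
    exact ⟨fun h => lt_of_mul_lt_mul_left h hε.le, fun h => mul_lt_mul_of_pos_left h hε⟩
  rw [← hpre, ← Measure.restrict_map (measurable_smul_euclidean3 ε) measurableSet_ball,
    Measure.map_addHaar_smul volume hε.ne', Measure.restrict_smul, finrank_euclideanSpace_fin,
    abs_inv, abs_of_pos (pow_pos hε 3)]

/-- **With a step size**: `(2π²/ε³) • Haar ≤ (d³A|_{|A|<π/ε}) ∘ (A ↦ exp(iεA·σ))⁻¹` for `ε > 0`. -/
theorem smul_haarProbability_le_map_expPauli_smul {ε : ℝ} (hε : 0 < ε) :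
    ENNReal.ofReal (2 * Real.pi ^ 2 / ε ^ 3) • haarProbability (Matrix.specialUnitaryGroup (Fin 2) ℂ) ≤
      (volume.restrict (ball (0 : EuclideanSpace ℝ (Fin 3)) (Real.pi / ε))).map (fun A : EuclideanSpace ℝ (Fin 3) => expPauli (ε • A)) := by
  have hcomp : (fun A : EuclideanSpace ℝ (Fin 3) => expPauli (ε • A)) = expPauli ∘ fun A : EuclideanSpace ℝ (Fin 3) => ε • A := rfl
  rw [hcomp, ← Measure.map_map measurable_expPauli (measurable_smul_euclidean3 ε), map_smul_restrict_ball hε,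
    show ε * (Real.pi / ε) = Real.pi by field_simp, Measure.map_smul]
  have hsplit : ENNReal.ofReal (2 * Real.pi ^ 2 / ε ^ 3) =
      ENNReal.ofReal ((ε ^ 3)⁻¹) * ENNReal.ofReal (2 * Real.pi ^ 2) := by
    rw [← ENNReal.ofReal_mul (by positivity), ← div_eq_inv_mul]
  rw [hsplit, ← smul_smul]
  refine Measure.le_iff'.2 fun s => ?_
  have hs := Measure.le_iff'.1 smul_haarProbability_le_map_expPauli s
  simp only [Measure.smul_apply, smul_eq_mul] at hs ⊢
  gcongr

/-! ## §3 A bounded kick before the drift, and the frozen link value after it -/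

/-- The translation `A ↦ v + A` is measurable. -/
theorem measurable_add_left_euclidean3 (v : EuclideanSpace ℝ (Fin 3)) : Measurable fun A : EuclideanSpace ℝ (Fin 3) => v + A := measurable_const_add v

/-- Translating Lebesgue measure on a ball translates the ball. -/
theorem map_add_left_restrict_ball (v : EuclideanSpace ℝ (Fin 3)) (R : ℝ) :
    (volume.restrict (ball (0 : EuclideanSpace ℝ (Fin 3)) R)).map (fun A : EuclideanSpace ℝ (Fin 3) => v + A) = volume.restrict (ball v R) := by
  have hpre : (fun A : EuclideanSpace ℝ (Fin 3) => v + A) ⁻¹' ball v R = ball 0 R := by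
    ext A
    simp [mem_ball, dist_eq_norm]
  rw [← hpre, ← Measure.restrict_map (measurable_add_left_euclidean3 v) measurableSet_ball, map_add_left_eq_self]

/-- **A bounded kick does not lose the injectivity ball**: if `r + |v| ≤ R` then Lebesgue measure on
the ball of radius `r` is dominated by the `v`-translate of Lebesgue measure on the ball of radius `R`. -/
theorem restrict_ball_le_map_add_left {v : EuclideanSpace ℝ (Fin 3)} {r R : ℝ} (h : r + ‖v‖ ≤ R) :
    volume.restrict (ball (0 : EuclideanSpace ℝ (Fin 3)) r) ≤ (volume.restrict (ball (0 : EuclideanSpace ℝ (Fin 3)) R)).map (fun A : EuclideanSpace ℝ (Fin 3) => v + A) := by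
  rw [map_add_left_restrict_ball]
  refine Measure.restrict_mono (ball_subset_ball' ?_) le_rfl
  rw [dist_comm, dist_zero_right]
  exact h

/-- The kicked drift `A ↦ exp(iε(v + A)·σ) · u` is continuous in the momentum `A`. -/
theorem continuous_kickDrift (ε : ℝ) (v : EuclideanSpace ℝ (Fin 3)) (u : Matrix.specialUnitaryGroup (Fin 2) ℂ) :
    Continuous fun A : EuclideanSpace ℝ (Fin 3) => expPauli (ε • (v + A)) * u :=
  (continuous_expPauli.comp ((continuous_const.add continuous_id).const_smul ε)).mul continuous_const

/-- … hence measurable. -/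
theorem measurable_kickDrift (ε : ℝ) (v : EuclideanSpace ℝ (Fin 3)) (u : Matrix.specialUnitaryGroup (Fin 2) ℂ) :
    Measurable fun A : EuclideanSpace ℝ (Fin 3) => expPauli (ε • (v + A)) * u :=
  (continuous_kickDrift ε v u).measurable

/-- **One kicked exponential drift of a ball-uniform momentum dominates a multiple of Haar measure,
uniformly in the kick and in the frozen link.**  For `ε > 0`, `π/ε + |v| ≤ R` and every `u ∈ SU(2)`:
`(2π²/ε³) • Haar ≤ (d³A|_{|A|<R}) ∘ (A ↦ exp(iε(v + A)·σ) · u)⁻¹`. -/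
theorem smul_haarProbability_le_map_kickDrift {ε : ℝ} (hε : 0 < ε) {v : EuclideanSpace ℝ (Fin 3)} {R : ℝ}
    (hR : Real.pi / ε + ‖v‖ ≤ R) (u : Matrix.specialUnitaryGroup (Fin 2) ℂ) :
    ENNReal.ofReal (2 * Real.pi ^ 2 / ε ^ 3) • haarProbability (Matrix.specialUnitaryGroup (Fin 2) ℂ) ≤
      (volume.restrict (ball (0 : EuclideanSpace ℝ (Fin 3)) R)).map (fun A : EuclideanSpace ℝ (Fin 3) => expPauli (ε • (v + A)) * u) := by
  have hcomp : (fun A : EuclideanSpace ℝ (Fin 3) => expPauli (ε • (v + A)) * u) =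
      (fun g : Matrix.specialUnitaryGroup (Fin 2) ℂ => g * u) ∘ ((fun B : EuclideanSpace ℝ (Fin 3) => expPauli (ε • B)) ∘ fun A : EuclideanSpace ℝ (Fin 3) => v + A) := rfl
  have hm1 : Measurable fun B : EuclideanSpace ℝ (Fin 3) => expPauli (ε • B) := measurable_expPauli.comp (measurable_smul_euclidean3 ε)
  have hm2 : Measurable fun g : Matrix.specialUnitaryGroup (Fin 2) ℂ => g * u := measurable_mul_const u
  rw [hcomp, ← Measure.map_map hm2 (hm1.comp (measurable_add_left_euclidean3 v)),
    ← Measure.map_map hm1 (measurable_add_left_euclidean3 v)]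
  calc ENNReal.ofReal (2 * Real.pi ^ 2 / ε ^ 3) • haarProbability (Matrix.specialUnitaryGroup (Fin 2) ℂ)
      = (ENNReal.ofReal (2 * Real.pi ^ 2 / ε ^ 3) • haarProbability (Matrix.specialUnitaryGroup (Fin 2) ℂ)).map (fun g : Matrix.specialUnitaryGroup (Fin 2) ℂ => g * u) := by
        rw [Measure.map_smul, map_mul_right_eq_self]
    _ ≤ ((volume.restrict (ball (0 : EuclideanSpace ℝ (Fin 3)) (Real.pi / ε))).map (fun B : EuclideanSpace ℝ (Fin 3) => expPauli (ε • B))).map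
          (fun g : Matrix.specialUnitaryGroup (Fin 2) ℂ => g * u) :=
        Measure.map_mono (smul_haarProbability_le_map_expPauli_smul hε) hm2
    _ ≤ (((volume.restrict (ball (0 : EuclideanSpace ℝ (Fin 3)) R)).map (fun A : EuclideanSpace ℝ (Fin 3) => v + A)).map
          (fun B : EuclideanSpace ℝ (Fin 3) => expPauli (ε • B))).map (fun g : Matrix.specialUnitaryGroup (Fin 2) ℂ => g * u) :=
        Measure.map_mono (Measure.map_mono (restrict_ball_le_map_add_left hR) hm1) hm2

/-! ## §4 The time-reversal law of the drift -/

/-- **`exp(−iA·σ) = exp(iA·σ)⁻¹`**: reversing the momentum inverts the drift factor (read through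
the unit quaternion `exp(ι x)` of the chart: `exp(−q) exp(q) = 1`). -/
theorem expPauli_neg (A : EuclideanSpace ℝ (Fin 3)) : expPauli (-A) = (expPauli A)⁻¹ := by
  letI : NormedAlgebra ℚ ℍ := .restrictScalars ℚ ℝ ℍ
  refine eq_inv_of_mul_eq_one_left ?_
  have hq : su2Quat (expPauli (-A) * expPauli A) = su2Quat (1 : Matrix.specialUnitaryGroup (Fin 2) ℂ) := by
    rw [T4HaarSU2Translate.su2Quat_mul, expPauli_eq_expPoint,
      expPauli_eq_expPoint, su2Quat_expPoint, su2Quat_expPoint,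
      T4HaarSU2Translate.su2Quat_one, map_neg, map_neg,
      ← exp_add_of_commute (Commute.neg_left (Commute.refl _)), neg_add_cancel, exp_zero]
  have h := congrArg Literature.MathematicalPhysics.QuantumLattice.quatMatrix hq
  rw [quatMatrix_su2Quat, quatMatrix_su2Quat] at h
  exact Subtype.ext h

end Summit.Ventures.LatticeQCDFlow.Exactness
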